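import Summits.HodgeConjecture.CorCM.IrreducibleOddWeightsHodgeGluingBlocks
import Summits.HodgeConjecture.CorCM.MumfordTateRankOfCMAbelianVariety
import Literature.AlgebraicGeometry.Milne1999.SpecialLefschetzGroupInvariantsCMType
import Literature.AlgebraicGeometry.HodgeTheory.HodgeConjectureAbelianSubquotients
import Literature.AlgebraicGeometry.Motives.AbelianVarietyIsogenyCancellation
import HarnessLib

/-!
# HODGE GLUING, INTRINSIC FORM: complex abelian varieties `X_1, …, X_n` of CM type with
# `dim MT(H¹(∏ X_j)) − 1 = Σ_j (dim MT(H¹ X_j) − 1)` — i.e. `Hg(∏_j X_j) = ∏_j Hg(X_j)` — satisfy: the Hodge conjecture for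
# the powers of the `X_j` implies the Hodge conjecture for every product of copies `∏_k X_{π k}`

COR-CM (cell `pub-hodgecm2`, binder seat `b16` gen 60, count-neutral claim HODGE GLUING, file G6 — complex abelian varieties
of CM type, NO CM data in the statement; theorems only, no definition, no named fact, no `sorry`).  NEW as stated, hence
under `Summits/`.  HONEST FRAMING: an unconditional reduction between instances of the Hodge conjecture (the Hodge
conjecture for the powers `X_j^{N+1}` is a HYPOTHESIS); `HC_CM` is neither used nor asserted.

THE THEOREM (**`hodgeConjectureFor_biproduct_of_mtRank_add_card_eq`**).  `X : Fin n → AbelianVariety ℂ` of CM type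
(`Milne1999.IsOfCMType`) and positive dimension with
`mtRank(H¹(⨁ X)) + n = Σ_j mtRank(H¹(X j)) + 1` (`mtRank` = the tree's `HodgeStructure.mtRank` = `dim MT`; since
`MT = 𝔾_m · Hg` this says `Hg(∏_j X_j) = ∏_j Hg(X_j)`).  IF the Hodge conjecture holds for every power `(X j)^{N+1}`,
THEN it holds for every `⨁_{k ∈ J} X (π k)` (`π : J → Fin n`, `J` finite non-empty) and everything isogenous.
PROOF.  Milne's regrouping `exists_isIsogeny_to_biproduct_of_classes_of_isOfCMType` writes `X j ∼ ⨁_i A_{j, cls i}` with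
CM realisations; the glued family over `Σ j, Fin (m_j + 1)` partitioned by `j` has block ranks `dim MT(H¹ X_j)` and total
rank `dim MT(H¹ ∏ X_j)` (`mtRank_hodge_one_eq_cmFamilyRank_of_isIsogenous_biproduct`), so the hypothesis is BLOCK
ADDITIVITY and file G5's `hodgeConjectureFor_biproduct_of_cmFamilyRank_fiber_add_card_eq` glues; the Hodge conjecture
for a product of copies of constituents of one `X j` comes from a power of `X j` (a retract, `HodgeConjectureFor.of_comp_eq_nsmul_id`).
For `n = 2` the rank hypothesis is Moonen–Zarhin's `Hg(X × Y) = Hg(X) × Hg(Y)` and the statement is the ⟸ half of their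
(3.1) turned into HC-gluing (`Pohlmann1968/HodgeClassesProductSpanCMProductsPowersIntrinsic`); here `n` factors.

## References

* [MoonenZarhin1999LowDim] B. Moonen, Yu. Zarhin, *Hodge classes on abelian varieties of low dimension*, Math. Ann.
  315 (1999), §2 (`MT = 𝔾_m · Hg`) and §3 (3.1).
* [Deligne1982HodgeCycles] P. Deligne, *Hodge cycles on abelian varieties*, LNM 900 (1982), I Ex. 3.7 (c).
* [Milne1999LefschetzClasses] J. S. Milne, *Lefschetz classes on abelian varieties*, Duke Math. J. 96 (1999), §1.
* [vanGeemen1994HodgeAV] B. van Geemen, LNM 1594 (1994), §3.5–3.7 Lemma 3.7.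
* [MumfordAV1970] D. Mumford, *Abelian Varieties* (1970), §19.
-/

set_option autoImplicit false

noncomputable section

open scoped BigOperators

open CategoryTheory CategoryTheory.Limits NumberField

namespace Summit.HodgeConjecture.CorCM

open Literature.NumberTheory.ComplexMultiplication
open Literature.AlgebraicGeometry.Motives
open Literature.AlgebraicGeometry.Motives.AbelianVariety
open Literature.AlgebraicGeometry.HodgeTheory
open Literature.AlgebraicGeometry.ComplexMultiplication (IsCMTypeRealisation)
open Literature.AlgebraicGeometry.Milne1999 (IsOfCMType exists_isIsogeny_to_biproduct_of_classes_of_isOfCMType)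
open Literature.AlgebraicGeometry.Pohlmann1968

/-! ### §1 Bookkeeping: flattening nested products, and sub-products of copies as retracts -/

section Bookkeeping

/-- **Flattening a product of products**: `⨁_j ⨁_{i ∈ D_j} B_{j,i} ≅ ⨁_{(j,i)} B_{j,i}` (an isogeny; both sides are the
product of all `B_{j,i}`). [cite: MumfordAV1970, §19] -/
theorem isIsogenous_biproduct_biproduct_sigma {J : Type} [Fintype J] {D : J → Type} [∀ j, Fintype (D j)]
    (B : ∀ j, D j → AbelianVariety ℂ) :
    IsIsogenous (⨁ fun j => ⨁ B j) (⨁ fun x : Σ j, D j => B x.1 x.2) := by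
  classical
  let f : (⨁ fun j => ⨁ B j) ⟶ ⨁ fun x : Σ j, D j => B x.1 x.2 :=
    biproduct.lift fun x => biproduct.π (fun j => ⨁ B j) x.1 ≫ biproduct.π (B x.1) x.2
  let g : (⨁ fun x : Σ j, D j => B x.1 x.2) ⟶ ⨁ fun j => ⨁ B j :=
    biproduct.lift fun j => biproduct.lift fun i => biproduct.π (fun x : Σ j, D j => B x.1 x.2) ⟨j, i⟩
  have hfg : f ≫ g = 𝟙 _ := by
    refine biproduct.hom_ext _ _ fun j => biproduct.hom_ext _ _ fun i => ?_
    simp only [f, g, Category.assoc, Category.id_comp, biproduct.lift_π]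
  have hgf : g ≫ f = 𝟙 _ := by
    refine biproduct.hom_ext _ _ fun x => ?_
    obtain ⟨j, i⟩ := x
    rw [Category.assoc, biproduct.lift_π, ← Category.assoc, biproduct.lift_π, biproduct.lift_π, Category.id_comp]
  exact ⟨f, isIsogeny_hom_of_iso ⟨f, g, hfg, hgf⟩⟩

/-- **A product of copies of constituents is a retract of the product of copies of the full products**: for
`B_{j,i}` and choices `φ : J → ι₀`, `ψ k ∈ D_{φ k}`, the Hodge conjecture for `⨁_k ⨁_i B_{φ k, i}` implies it for
`⨁_k B_{φ k, ψ k}` (slot `ψ k` in, projection out, composite the identity). [cite: MumfordAV1970, §19]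
[cite: vanGeemen1994HodgeAV, §3.5–3.7 Lemma 3.7 (p. 236)] -/
theorem hodgeConjectureFor_biproduct_apply_of_biproduct_biproduct {ι₀ : Type} {D : ι₀ → Type} [∀ j, Fintype (D j)]
    (B : ∀ j, D j → AbelianVariety ℂ) {J : Type} [Fintype J] (φ : J → ι₀) (ψ : ∀ k, D (φ k))
    (hHC : HodgeConjectureFor (⨁ fun k => ⨁ B (φ k)).dim (⨁ fun k => ⨁ B (φ k)).X) :
    HodgeConjectureFor (⨁ fun k => B (φ k) (ψ k)).dim (⨁ fun k => B (φ k) (ψ k)).X := by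
  classical
  refine HodgeConjectureFor.of_comp_eq_nsmul_id
    (biproduct.map fun k => biproduct.ι (B (φ k)) (ψ k)) (biproduct.map fun k => biproduct.π (B (φ k)) (ψ k))
    one_ne_zero ?_ hHC
  rw [one_smul]
  refine biproduct.hom_ext _ _ fun k => ?_
  rw [Category.assoc, biproduct.map_π, ← Category.assoc, biproduct.map_π, Category.assoc, biproduct.ι_π_self,
    Category.comp_id, Category.id_comp]

end Bookkeeping

/-! ### §2 The intrinsic gluing theorem -/

section Intrinsic

variable [HodgeTensorFacts.{0, 0}]

/-- **HODGE GLUING FOR ABELIAN VARIETIES OF CM TYPE WITH `Hg(∏_j X_j) = ∏_j Hg(X_j)`.**  `X : Fin n → AbelianVariety ℂ`,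
each of CM type and positive dimension, with `dim MT(H¹(⨁ X)) + n = Σ_j dim MT(H¹(X j)) + 1` (Mumford–Tate ranks of the
rational Hodge structures `H¹(−, ℚ)`; the smooth-projective witnesses are arbitrary, e.g. `isSmoothProjective_holds`).
IF the Hodge conjecture holds for all powers `(X j)^{N+1}`, THEN it holds for every product of copies `⨁_{k ∈ J} X (π k)`.
No CM types, fields or realisations appear in the statement; no factor needs to be simple or nondegenerate.
[cite: MoonenZarhin1999LowDim, §2 and §3 (3.1)] [cite: Deligne1982HodgeCycles, I Ex. 3.7 (c)]
[cite: Milne1999LefschetzClasses, §1 Prop. 1.1 (p. 643)] [cite: vanGeemen1994HodgeAV, §3.5–3.7 Lemma 3.7 (p. 236)] -/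
theorem hodgeConjectureFor_biproduct_of_mtRank_add_card_eq {n : ℕ} (X : Fin n → AbelianVariety ℂ)
    (hX0 : ∀ j, 0 < (X j).dim) (hcm : ∀ j, IsOfCMType (X j)) {kX : Fin n → ℕ}
    (hX : ∀ j, IsSmoothProjective (kX j) (X j).X) {kP : ℕ} (hP : IsSmoothProjective kP (⨁ X).X)
    (hadd : haveI := BettiUniverse.finite hP 1
      haveI := fun j => BettiUniverse.finite (hX j) 1
      (BettiUniverse.hodge exists_isReal_hodgeModel_holds hP 1).mtRank + n =
        (∑ j, (BettiUniverse.hodge exists_isReal_hodgeModel_holds (hX j) 1).mtRank) + 1)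
    (hHC : ∀ (j : Fin n) (N : ℕ), HodgeConjectureFor ((X j).powSucc N).dim ((X j).powSucc N).X)
    {J : Type} [Fintype J] [Nonempty J] (π : J → Fin n) :
    HodgeConjectureFor (⨁ fun k => X (π k)).dim (⨁ fun k => X (π k)).X := by
  classical
  -- Milne's regrouping of every factor
  choose C instC K instF instNF instCM Φ A ι θ m cls f hA _h1 _h2 hf using
    fun j => exists_isIsogeny_to_biproduct_of_classes_of_isOfCMType (hX0 j) (hcm j)
  -- the glued family: slots `x = (j, i)`, member `A j (cls j i)`, block `j`
  let I' : Type := Σ j : Fin n, Fin (m j + 1)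
  let K' : I' → Type := fun x => K x.1 (cls x.1 x.2)
  letI : ∀ x : I', Field (K' x) := fun x => instF x.1 (cls x.1 x.2)
  letI : ∀ x : I', NumberField (K' x) := fun x => instNF x.1 (cls x.1 x.2)
  haveI : ∀ x : I', IsCMField (K' x) := fun x => instCM x.1 (cls x.1 x.2)
  let Φ' : ∀ x : I', CMType (K' x) := fun x => Φ x.1 (cls x.1 x.2)
  let A' : I' → AbelianVariety ℂ := fun x => A x.1 (cls x.1 x.2)
  have hA' : ∀ x : I', IsCMTypeRealisation (Φ' x) (A' x) (ι x.1 (cls x.1 x.2)) (θ x.1 (cls x.1 x.2)) :=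
    fun x => hA x.1 (cls x.1 x.2)
  have hκ : Function.Surjective (fun x : I' => x.1) := fun j => ⟨⟨j, 0⟩, rfl⟩
  -- each factor is isogenous to the product of its block, the full product to the product of the glued family
  have hXj : ∀ j, IsIsogenous (X j) (⨁ fun i : Fin (m j + 1) => A j (cls j i)) := fun j => ⟨f j, hf j⟩
  have hPB : IsIsogenous (⨁ X) (⨁ fun x : I' => A' x) :=
    (IsIsogenous.biproduct hXj).trans (isIsogenous_biproduct_biproduct_sigma fun j i => A j (cls j i))
  -- the Mumford–Tate ranks are the ranks of the glued family and of its blocks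
  have hrankP : haveI := BettiUniverse.finite hP 1
      (BettiUniverse.hodge exists_isReal_hodgeModel_holds hP 1).mtRank = CMAlgebra.cmFamilyRank Φ' :=
    mtRank_hodge_one_eq_cmFamilyRank_of_isIsogenous_biproduct (cls := fun x : I' => x) hA'
      Function.surjective_id hP hPB
  have hrankX : ∀ j, haveI := BettiUniverse.finite (hX j) 1
      (BettiUniverse.hodge exists_isReal_hodgeModel_holds (hX j) 1).mtRank =
        CMAlgebra.cmFamilyRank fun i : Fin (m j + 1) => Φ j (cls j i) := fun j =>
    mtRank_hodge_one_eq_cmFamilyRank_of_isIsogenous_biproduct (cls := fun i : Fin (m j + 1) => i)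
      (fun i => hA j (cls j i)) Function.surjective_id (hX j) (hXj j)
  have hblock : ∀ j, CMAlgebra.cmFamilyRank (fun x : {x : I' // x.1 = j} => Φ' x.1) =
      CMAlgebra.cmFamilyRank fun i : Fin (m j + 1) => Φ j (cls j i) := by
    intro j
    have hsurj : Function.Surjective fun i : Fin (m j + 1) => (⟨⟨j, i⟩, rfl⟩ : {x : I' // x.1 = j}) := by
      rintro ⟨⟨j', i⟩, h⟩
      change j' = j at h
      subst h
      exact ⟨i, rfl⟩
    exact (CMAlgebra.cmFamilyRank_comp_of_surjective (fun x : {x : I' // x.1 = j} => Φ' x.1) hsurj).symm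
  have hadd' : CMAlgebra.cmFamilyRank Φ' + Fintype.card (Fin n) =
      (∑ j, CMAlgebra.cmFamilyRank fun x : {x : I' // x.1 = j} => Φ' x.1) + 1 := by
    rw [Fintype.card_fin, ← hrankP, Finset.sum_congr rfl fun j _ => (hblock j).trans (hrankX j).symm]
    exact hadd
  -- the Hodge conjecture inside a block: a product of copies of constituents of `X j` is a retract of a power of `X j`
  have hHCblock : ∀ (j : Fin n) (J₀ : Type) [Fintype J₀] [Nonempty J₀] (π₀ : J₀ → {x : I' // x.1 = j}),
      HodgeConjectureFor (⨁ fun k => A' (π₀ k).1).dim (⨁ fun k => A' (π₀ k).1).X := by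
    intro j J₀ _ _ π₀
    have hfun : (fun k => X (π₀ k).1.1) = fun _ : J₀ => X j := funext fun k => by rw [(π₀ k).2]
    have h1 : HodgeConjectureFor (⨁ fun k => X (π₀ k).1.1).dim (⨁ fun k => X (π₀ k).1.1).X := by
      rw [hfun]
      exact hodgeConjectureFor_biproduct_const_of_powSucc (hHC j)
    have h2 : HodgeConjectureFor (⨁ fun k => ⨁ fun i : Fin (m (π₀ k).1.1 + 1) => A (π₀ k).1.1 (cls (π₀ k).1.1 i)).dim
        (⨁ fun k => ⨁ fun i : Fin (m (π₀ k).1.1 + 1) => A (π₀ k).1.1 (cls (π₀ k).1.1 i)).X :=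
      HodgeConjectureFor.of_isIsogenous' (IsIsogenous.biproduct fun k => hXj (π₀ k).1.1) h1
    exact hodgeConjectureFor_biproduct_apply_of_biproduct_biproduct (fun j i => A j (cls j i)) (fun k => (π₀ k).1.1)
      (fun k => (π₀ k).1.2) h2
  -- glue along the blocks, for the product of copies `(k, i) ↦ A (π k) (cls (π k) i)`
  obtain ⟨k₀⟩ := ‹Nonempty J›
  haveI : Nonempty (Σ k : J, Fin (m (π k) + 1)) := ⟨⟨k₀, 0⟩⟩
  have hglued := hodgeConjectureFor_biproduct_of_cmFamilyRank_fiber_add_card_eq (Φ := Φ') (A := A')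
    (fun x : I' => x.1) hκ hadd' hA' hHCblock (fun y : Σ k : J, Fin (m (π k) + 1) => (⟨π y.1, y.2⟩ : I'))
  -- and transport to `⨁_k X (π k)`
  exact HodgeConjectureFor.of_isIsogenous
    ((IsIsogenous.biproduct fun k => hXj (π k)).trans
      (isIsogenous_biproduct_biproduct_sigma fun k i => A (π k) (cls (π k) i))) hglued

/-- **Isogenous carriers**: under the same hypotheses the Hodge conjecture holds for every abelian variety isogenous to a
product of copies `⨁_k X (π k)` (e.g. `∏_j X_j^{a_j}` in any bracketing). [cite: vanGeemen1994HodgeAV, §3.5–3.7 Lemma 3.7 (p. 236)]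
[cite: MoonenZarhin1999LowDim, §3 (3.1)] -/
theorem hodgeConjectureFor_of_isIsogenous_biproduct_of_mtRank_add_card_eq {n : ℕ} (X : Fin n → AbelianVariety ℂ)
    (hX0 : ∀ j, 0 < (X j).dim) (hcm : ∀ j, IsOfCMType (X j)) {kX : Fin n → ℕ}
    (hX : ∀ j, IsSmoothProjective (kX j) (X j).X) {kP : ℕ} (hP : IsSmoothProjective kP (⨁ X).X)
    (hadd : haveI := BettiUniverse.finite hP 1
      haveI := fun j => BettiUniverse.finite (hX j) 1
      (BettiUniverse.hodge exists_isReal_hodgeModel_holds hP 1).mtRank + n =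
        (∑ j, (BettiUniverse.hodge exists_isReal_hodgeModel_holds (hX j) 1).mtRank) + 1)
    (hHC : ∀ (j : Fin n) (N : ℕ), HodgeConjectureFor ((X j).powSucc N).dim ((X j).powSucc N).X)
    {J : Type} [Fintype J] [Nonempty J] (π : J → Fin n) {Y : AbelianVariety ℂ}
    (hY : IsIsogenous Y (⨁ fun k => X (π k))) : HodgeConjectureFor Y.dim Y.X :=
  HodgeConjectureFor.of_isIsogenous hY (hodgeConjectureFor_biproduct_of_mtRank_add_card_eq X hX0 hcm hX hP hadd hHC π)

/-- **The full product**: `Hg(∏_j X_j) = ∏_j Hg(X_j)` (as the Mumford–Tate rank identity) and the Hodge conjecture for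
the powers of the `X_j` give the Hodge conjecture for `∏_j X_j` itself. [cite: MoonenZarhin1999LowDim, §3 (3.1)] -/
theorem hodgeConjectureFor_biproduct_univ_of_mtRank_add_card_eq {n : ℕ} [NeZero n] (X : Fin n → AbelianVariety ℂ)
    (hX0 : ∀ j, 0 < (X j).dim) (hcm : ∀ j, IsOfCMType (X j)) {kX : Fin n → ℕ}
    (hX : ∀ j, IsSmoothProjective (kX j) (X j).X) {kP : ℕ} (hP : IsSmoothProjective kP (⨁ X).X)
    (hadd : haveI := BettiUniverse.finite hP 1
      haveI := fun j => BettiUniverse.finite (hX j) 1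
      (BettiUniverse.hodge exists_isReal_hodgeModel_holds hP 1).mtRank + n =
        (∑ j, (BettiUniverse.hodge exists_isReal_hodgeModel_holds (hX j) 1).mtRank) + 1)
    (hHC : ∀ (j : Fin n) (N : ℕ), HodgeConjectureFor ((X j).powSucc N).dim ((X j).powSucc N).X) :
    HodgeConjectureFor (⨁ X).dim (⨁ X).X :=
  hodgeConjectureFor_biproduct_of_mtRank_add_card_eq X hX0 hcm hX hP hadd hHC id

end Intrinsic

end Summit.HodgeConjecture.CorCM

end
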